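import Mathlib
import HarnessLib
import Summits.HubbardSuperconductivity.HubbardSuperconductivity.Theorems.KLProgrammeKLRegimeSplitTwoLegSizesMSOfCurveJet

/-!
# K3 ENGINE child (stmt-HubbardSuperconductivity-20236 `KLRegimeEngineV16`) — the MULTI-SLOT ANGULAR curve-jet predicate `TwoLegCurveJetBoundMS`
# (statements only: the def, its symmetric-profile carrier, the single-slot embedding)

Cell gate-hubbard-kl, seat hubbard-kl-k3c3-p3 (g5, MS lane).  Companion of p2's `…TwoLegCurvatureDefs` (`TwoLegCurveJetBound`: single-slot, class-level)
and of p520144 `…TwoLegSizesMSOfCurveJet`.  Why a multi-slot ANGULAR predicate (memo HOME/hubbard-kl-k3c3-p3/MS-TRANSPORT.md = evidence #31 on 20236): the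
curve profile `δ_n = F_n ∘ γ_K` reads the increment symbol at the frame's own Fermi point, so its `θ`-jets of order `3, 4` carry the TRANSPORT
`∂_r F_n(γ_K)·∂_θ^k u_K` of the frame's fine pieces (`≍ s_n·Gfr_k·U²·4^{(k−2)m}` for the piece at scale `m`) — content no `n`-keyed class-level bar holds
(`4^{(k−2)N}` summed over the pieces), exactly the MS-A34 mechanism the V16 multi-slot text `TwoLegSizesMSTQ` exists for.  The angular form of that text:

* `IsSymmetricProfile f` — `C⁴`, `2π`-periodic, even, `(π/2 − ·)`-invariant (what the G-extension needs to emit a symmetric `C⁴` frame);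
* **`TwoLegCurveJetBoundMS L M c c' e R β U μ K n`** — an angular split `δ_n = δp n + Σ_{m ∈ Ioc n (nScales β)} δp m` into symmetric profiles with BASE jets
  `|∂^k δp n| ≤ curveJetBar c c' U k n` and SLOT jets `|∂^k δp m| ≤ e·pieceSize R U m k` (`k ≤ 4`; `e` = the transport allowance, to be fitted against
  `msBarQ G Q U n`);
* `twoLegCurveJetBoundMS_of_curveJetBound` — the single-slot predicate embeds (trivial split, any `e ≥ 0`);
* §2 (append, plan g16 (R26′)) `TwoLegCurveJetSplit … δp` — the same four conjuncts for a NAMED split (`TwoLegCurveJetBoundMS ↔ ∃ δp, …`), monotone in `(c, c', e)`.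

Consumer (slot by slot ⇒ `TwoLegSizesMSWith/MSTQ`): `…TwoLegSizesMSOfCurveJetMS`.  Statements and bookkeeping only; nothing about the model is asserted.
References: BGM 2006 §2.4 (2.36), Thm 3.1 (3.2)–(3.3) [cite: BenfattoGiulianiMastropietro2006].
-/

noncomputable section

namespace Summit.HubbardSuperconductivity.HubbardSuperconductivity.Theorems.KLRegimeSplit

set_option linter.dupNamespace false -- summit = problem name (single-conjunct summit), D-0017

open Real Finset MeasureTheory Literature.MathematicalPhysics.QuantumLattice Literature.MathematicalPhysics.QuantumLattice.FermiRG
open Literature.Probability.LatticeModels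
open Summit.HubbardSuperconductivity.HubbardSuperconductivity.Theorems.PerturbedFermiCurve

/-! ## §1 The multi-slot angular curve-jet predicate -/

/-- **A `D₄`-symmetric `C⁴` angular profile**: `C⁴`, `2π`-periodic, even, and invariant under `θ ↦ π/2 − θ` (what `isSymmetricFrame_piece` needs). -/
def IsSymmetricProfile (f : ℝ → ℝ) : Prop :=
  ContDiff ℝ 4 f ∧ Function.Periodic f (2 * π) ∧ (∀ θ, f (-θ) = f θ) ∧ (∀ θ, f (π / 2 - θ) = f θ)

section Defs

variable (L M : ℕ) [NeZero L] [NeZero M]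

/-- **`TwoLegCurveJetBoundMS L M c c' e R β U μ K n`** — the MULTI-SLOT angular curve-jet bound of the scale-`n` profile: an angular split
`δ_n = δp n + Σ_{m ∈ Ioc n (nScales β)} δp m` into `D₄`-symmetric `C⁴` profiles, the base within `curveJetBar c c' U k n`, the slot-`m` part within
`e·pieceSize R U m k` (`k ≤ 4`; `e` = the transport allowance, intended `≤ msBarQ G Q U n`-type). -/
def TwoLegCurveJetBoundMS (c c' : ℕ → ℝ) (e : ℝ) (R : RenConsts) (β U μ : ℝ) (K : TrigPolyC4v) (n : ℕ) : Prop :=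
  ∃ δp : ℕ → ℝ → ℝ,
    (∀ θ : ℝ, klTwoLegCurveProfile L M β U μ K n θ = δp n θ + ∑ m ∈ Ioc n (nScales β), δp m θ) ∧
    (∀ m, IsSymmetricProfile (δp m)) ∧
    (∀ k ≤ 4, ∀ θ : ℝ, |iteratedDeriv k (δp n) θ| ≤ curveJetBar c c' U k n) ∧
    (∀ m ∈ Ioc n (nScales β), ∀ k ≤ 4, ∀ θ : ℝ, |iteratedDeriv k (δp m) θ| ≤ e * pieceSize R U m k)

end Defs

section Basic

variable {L M : ℕ} [NeZero L] [NeZero M] {c c' : ℕ → ℝ} {e : ℝ} {R : RenConsts} {β U μ : ℝ} {K : TrigPolyC4v} {n : ℕ}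

/-- The curve profile at every scale is even (unconditionally). -/
theorem klTwoLegCurveProfile_neg (β U μ : ℝ) (K : TrigPolyC4v) (n : ℕ) (θ : ℝ) :
    klTwoLegCurveProfile L M β U μ K n (-θ) = klTwoLegCurveProfile L M β U μ K n θ := by
  rcases n with _ | n
  · simp only [klTwoLegCurveProfile_zero, klLocalPart_neg, frameOnCurve_neg]
  · simp only [klTwoLegCurveProfile_succ, klLocalPart_neg]

/-- The curve profile at every scale is `(π/2 − ·)`-invariant (unconditionally). -/
theorem klTwoLegCurveProfile_pi_div_two_sub (β U μ : ℝ) (K : TrigPolyC4v) (n : ℕ) (θ : ℝ) :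
    klTwoLegCurveProfile L M β U μ K n (π / 2 - θ) = klTwoLegCurveProfile L M β U μ K n θ := by
  rcases n with _ | n
  · simp only [klTwoLegCurveProfile_zero, klLocalPart_pi_div_two_sub, frameOnCurve_pi_div_two_sub]
  · simp only [klTwoLegCurveProfile_succ, klLocalPart_pi_div_two_sub]

/-- The zero profile is a symmetric profile. -/
theorem isSymmetricProfile_zero : IsSymmetricProfile (fun _ : ℝ => (0 : ℝ)) :=
  ⟨contDiff_const, fun _ => rfl, fun _ => rfl, fun _ => rfl⟩

/-- **The single-slot case**: `TwoLegCurveJetBound c c' … K n` gives `TwoLegCurveJetBoundMS c c' e R … K n` for every `e ≥ 0` (trivial split,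
`δp n := δ_n`, `δp m := 0`; needs `0 ≤ R.Gfr j`). -/
theorem twoLegCurveJetBoundMS_of_curveJetBound (h : TwoLegCurveJetBound L M c c' β U μ K n) (he : 0 ≤ e) (hR : ∀ j, 0 ≤ R.Gfr j) :
    TwoLegCurveJetBoundMS L M c c' e R β U μ K n := by
  classical
  refine ⟨fun m => if m = n then klTwoLegCurveProfile L M β U μ K n else fun _ => 0, fun θ => ?_, fun m => ?_, fun k hk θ => ?_,
    fun m hm k hk θ => ?_⟩
  · have hzero : ∀ m ∈ Ioc n (nScales β), (if m = n then klTwoLegCurveProfile L M β U μ K n else fun _ => (0 : ℝ)) θ = 0 := by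
      intro m hm
      have hne : m ≠ n := by have := (mem_Ioc.mp hm).1; omega
      simp [hne]
    rw [sum_eq_zero hzero]; simp
  · by_cases hm : m = n
    · simp only [hm, if_true]
      exact ⟨h.1, klTwoLegCurveProfile_periodic β U μ K n, klTwoLegCurveProfile_neg β U μ K n, klTwoLegCurveProfile_pi_div_two_sub β U μ K n⟩
    · simp only [hm, if_false]; exact isSymmetricProfile_zero
  · simp only [if_true]; exact h.2 k hk θ
  · have hne : m ≠ n := by have := (mem_Ioc.mp hm).1; omega
    simp only [hne, if_false]
    -- `iteratedDeriv k (fun _ => 0) θ = 0` for every `k`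
    have hz : iteratedDeriv k (fun _ : ℝ => (0 : ℝ)) θ = 0 := by
      rw [iteratedDeriv_const]; simp
    have := mul_nonneg he (pieceSize_nonneg hR U m k)
    simpa [hz] using this

end Basic

/-! ## §2 (append, plan g16 (R26′)) The split as a PARAMETER: `TwoLegCurveJetSplit … δp` -/

section Split

variable (L M : ℕ) [NeZero L] [NeZero M]

/-- **`TwoLegCurveJetSplit L M c c' e R β U μ K n δp`** — the multi-slot angular curve-jet bound FOR A NAMED SPLIT `δp : ℕ → ℝ → ℝ` (the four conjuncts of
`TwoLegCurveJetBoundMS` with the witness exposed), so that a supplier can state its canonical frame-telescoped split by name (plan g16 (R26′): base =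
the profile at the frame truncated at `n` with all finer θ-constant parts included, slot `m` = switching on the oscillating part of piece `m`). -/
def TwoLegCurveJetSplit (c c' : ℕ → ℝ) (e : ℝ) (R : RenConsts) (β U μ : ℝ) (K : TrigPolyC4v) (n : ℕ) (δp : ℕ → ℝ → ℝ) : Prop :=
  (∀ θ : ℝ, klTwoLegCurveProfile L M β U μ K n θ = δp n θ + ∑ m ∈ Ioc n (nScales β), δp m θ) ∧
    (∀ m, IsSymmetricProfile (δp m)) ∧
    (∀ k ≤ 4, ∀ θ : ℝ, |iteratedDeriv k (δp n) θ| ≤ curveJetBar c c' U k n) ∧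
    (∀ m ∈ Ioc n (nScales β), ∀ k ≤ 4, ∀ θ : ℝ, |iteratedDeriv k (δp m) θ| ≤ e * pieceSize R U m k)

variable {L M}

/-- `TwoLegCurveJetBoundMS` is `∃ δp, TwoLegCurveJetSplit … δp` (by `Iff.rfl`). -/
theorem twoLegCurveJetBoundMS_iff_exists_split (c c' : ℕ → ℝ) (e : ℝ) (R : RenConsts) (β U μ : ℝ) (K : TrigPolyC4v) (n : ℕ) :
    TwoLegCurveJetBoundMS L M c c' e R β U μ K n ↔ ∃ δp, TwoLegCurveJetSplit L M c c' e R β U μ K n δp := Iff.rfl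

/-- A named split gives the existential predicate. -/
theorem TwoLegCurveJetSplit.toMS {c c' : ℕ → ℝ} {e : ℝ} {R : RenConsts} {β U μ : ℝ} {K : TrigPolyC4v} {n : ℕ} {δp : ℕ → ℝ → ℝ}
    (h : TwoLegCurveJetSplit L M c c' e R β U μ K n δp) : TwoLegCurveJetBoundMS L M c c' e R β U μ K n := ⟨δp, h⟩

/-- **Monotonicity of a named split in the allowances** (the registrant's fit): `c ≤ d`, `c' ≤ d'`, `e ≤ e'` pointwise transport the bound
(nonnegative `R.Gfr`). -/
theorem TwoLegCurveJetSplit.mono {c c' d d' : ℕ → ℝ} {e e' : ℝ} {R : RenConsts} (hR : ∀ j, 0 ≤ R.Gfr j) (hcd : ∀ k, c k ≤ d k)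
    (hcd' : ∀ k, c' k ≤ d' k) (hee' : e ≤ e') {β U μ : ℝ} {K : TrigPolyC4v} {n : ℕ} {δp : ℕ → ℝ → ℝ}
    (h : TwoLegCurveJetSplit L M c c' e R β U μ K n δp) : TwoLegCurveJetSplit L M d d' e' R β U μ K n δp := by
  obtain ⟨hsplit, hsym, hbase, hslot⟩ := h
  refine ⟨hsplit, hsym, fun k hk θ => (hbase k hk θ).trans (curveJetBar_mono hcd hcd' U k n), fun m hm k hk θ => (hslot m hm k hk θ).trans ?_⟩
  exact mul_le_mul_of_nonneg_right hee' (pieceSize_nonneg hR U m k)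

/-- Monotonicity of the existential predicate in the allowances. -/
theorem TwoLegCurveJetBoundMS.mono {c c' d d' : ℕ → ℝ} {e e' : ℝ} {R : RenConsts} (hR : ∀ j, 0 ≤ R.Gfr j) (hcd : ∀ k, c k ≤ d k)
    (hcd' : ∀ k, c' k ≤ d' k) (hee' : e ≤ e') {β U μ : ℝ} {K : TrigPolyC4v} {n : ℕ}
    (h : TwoLegCurveJetBoundMS L M c c' e R β U μ K n) : TwoLegCurveJetBoundMS L M d d' e' R β U μ K n := by
  obtain ⟨δp, hδ⟩ := h
  exact ⟨δp, TwoLegCurveJetSplit.mono hR hcd hcd' hee' hδ⟩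

end Split

end Summit.HubbardSuperconductivity.HubbardSuperconductivity.Theorems.KLRegimeSplit

end
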